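import Literature.NumberTheory.EllipticCurves.IwasawaAlgebraSpecializationTorsionBoundProofs
import Literature.NumberTheory.EllipticCurves.IwasawaAlgebraEisensteinQuotientDVRProofs
import HarnessLib

/-!
# A non-torsion element of a finitely generated `Λ`-module survives specialisation at
# Howard's Eisenstein primes `q_m = T^m + p` for all but finitely many `m`
# (module theory over `Λ = ℤ_p⟦T⟧`; proofs file)

Topic `NumberTheory/EllipticCurves`. THEOREMS ONLY (no definition, no named fact, no instance, no
`sorry`), in the vocabulary of the tree (`IwasawaAlgebra p = PowerSeries ℤ_[p]`, the pointwise
submodule `q • ⊤ = qM`, `Module.Finite`, `Set.Infinite`), continuing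
`IwasawaAlgebraSpecializationTorsionBoundProofs` (§2 there: a non-zero `f ∈ Λ` is divisible by `q_m`
for only finitely many `m ≥ 1`).

WHAT. Let `M` be a finitely generated `Λ`-module, `q_m = T^m + p` (`m ≥ 1`, pairwise non-associated
prime elements of `Λ`), `S_m = Λ/(q_m)` (a discrete valuation ring, `ℤ_p`-free of rank `m`).

* §1 (`exists_linearIndependent_ne_zero_forall_smul_mem_span`, any domain `R`): a finitely generated
  `R`-module is pushed by ONE non-zero scalar `d` into the free submodule spanned by a maximal linearly
  independent subset (`d • M ⊆ ⊕ R sᵢ`).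
* §2 (MAIN, `exists_ne_zero_and_smul_eq_zero_of_infinite`): if for infinitely many `m ≥ 1` there is
  `λ_m ∈ Λ` with `q_m ∤ λ_m` and `λ_m y ∈ q_m M` — i.e. the image of `y` in the `S_m`-module `M/q_m M`
  is `S_m`-torsion — then `y` is a `Λ`-torsion element (`d y = 0` for some `d ≠ 0`). Corollaries:
  `y ∈ q_m M` for infinitely many `m` forces `y` torsion (`…_of_infinite_setOf_mem_smul_top`), so in
  a torsion-free module `y = 0`; `⋂_{m ∈ I} q_m M ⊆ M_{Λ-tors}` for every infinite `I ⊆ ℕ`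
  (`iInf_smul_top_le_torsion`), `= 0` if `M` is torsion-free.
* §3 (eventual forms): a NON-torsion `y` has, for all `m ≥ m₁(y)`, an `S_m`-torsion-free image in
  `M/q_m M` (`exists_forall_not_mem_smul_top_of_not_dvd`; in particular `y ∉ q_m M`); the same for any
  family of submodules `K_m` with `d · K_m ⊆ q_m M` for one `d ≠ 0` (`exists_forall_smul_not_mem_of_forall_smul_mem`).
* §4 (map form = the use): for `Λ`-linear maps `f_m : M → H_m` (`m ≥ m₀`) whose kernels are
  controlled by an ambient finitely generated module `M'` through `ι : M → M'`
  (`f_m x = 0 ⟹ ι x ∈ q_m M'`), and `y ∈ M` with `ι y` non-torsion: `λ · f_m(y) ≠ 0` for every `λ`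
  with `q_m ∤ λ` and all `m ≥ m₁` (`exists_forall_smul_map_ne_zero`), in particular `f_m(y) ≠ 0` and
  `f_m(L) ≠ 0` for every submodule `L ∋ y` (`exists_forall_map_ne_bot`); on an `S_m`-module the
  `λ`-form says the element is `S_m`-torsion-free (`forall_quotient_smul_ne_zero_of_forall_smul_ne_zero`).
* §5 (the generator): on `H₀ ≃ S_m` every `Λ`-submodule is `Λ ∙ κ₁`
  (`exists_eq_span_singleton_of_linearEquiv_quotient`), so `f(L) ≠ 0` yields `f(L) = Λ ∙ κ₁`, `κ₁ ≠ 0`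
  (`exists_ne_zero_map_eq_span_singleton`) — the binders `hL`, `hκ` of the specialised witness.
* §6 (generator among the given ones): over a local ring a principal `span A` is `R ∙ a` with `a ∈ A`
  (`exists_mem_span_eq_span_singleton_of_span_eq`); hence on `H₀ ≃ S_m`, `f(Λ·A) = Λ ∙ f(s)` with
  `s ∈ A` (`exists_mem_map_span_eq_span_singleton`, `…_ne_zero`) — `κ₁` is an actual specialised class.

WHY (use). This is the algebra behind the first sentence of Howard's proof of the anticyclotomic
main conjecture divisibility [Howard 2004, proof of Thm. 2.2.10 (= Thm. 3.2.10 of the arXiv text,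
p. 17): "It follows from
Proposition (control) and Lemma (torsion free) that `κ₁^{(𝔭)}` generates an infinite `S_𝔭`-submodule
of `H¹_{F_𝔭}(K, T_𝔭)` for all but finitely many height-one primes. We let `Σ_Λ` be a finite set of
height-one primes of `Λ` containing those primes for which `κ₁^{(𝔭)}` has finite order …"; and
p. 18: "The case `𝔭 = pΛ` is dealt with in an entirely similar fashion, taking `𝔮 = T^m + p`"]: the
auxiliary prime `𝔮 = q_m` must avoid `Σ_Λ`, which it does for `m ≫ 0` PROVIDED the non-vanishing of
the specialised class is available along the Eisenstein family — §4 with `M = 𝔖 ⊆ M' = H¹(K, 𝐓)`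
(finitely generated over `Λ`), `f_m` the specialisation map to `H¹(K, T_{q_m})` (whose kernel lies in
`q_m H¹(K, 𝐓)` by the cohomology sequence of `0 → 𝐓 →(q_m)→ 𝐓 → T_{q_m} → 0`) and `y = κ_∞`
non-torsion. In cell `pub/bsd-print-x9` (shared `μ`-part crux of routes PrintX9 / PrintX10b, port
road D1, memo PORT-ALGEBRA-LAYER §6(a)) this supplies the binder `hκ : κ₁ ≠ 0` of
`Theorems/PrintX9MuPartSpecWitnessOfDVRData.nonempty_specWitness_of_dvrData` for every `m ≥ m₁` from
ONE non-torsion class, with `κ₁` a generator of `f_m(Λκ_∞)`; the stronger `S_m`-torsion-freeness of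
§4 is Howard's "generates an infinite `S_𝔮`-submodule". Mechanism: Greenberg's generic-specialisation
count [Greenberg LNM 1716, §4 p. 117] in the coordinates of a free envelope (§1) — `q_m ∣ λ_m cᵢ`,
`q_m` prime, `q_m ∤ λ_m` give `q_m ∣ cᵢ`, and a non-zero coordinate has only finitely many Eisenstein
divisors (`finite_setOf_X_pow_add_C_dvd`). Nothing about Selmer groups or Galois cohomology is
asserted here; no statement of the summit is proved by this file.

References: [Howard2004HeegnerKolyvagin] B. Howard, *The Heegner point Kolyvagin system*, Compositio
Math. 140 (2004) 1439–1472, proof of Thm. 2.2.10; [GreenbergLNM1716] R. Greenberg, *Iwasawa theory for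
elliptic curves*, LNM 1716 (1999), §4 p. 117; [Washington1997] L. Washington, *Introduction to
Cyclotomic Fields*, §13.2 (`Λ` is a UFD); [NeukirchSchmidtWingberg2008] Ch. V §1, (5.1.7)–(5.1.10)
(structure of finitely generated `Λ`-modules up to pseudo-isomorphism; free envelopes);
[SerreLocalFields1979] J.-P. Serre, *Local Fields*, I §6 (Eisenstein polynomials, `S_m` a DVR).
-/

noncomputable section

open scoped Classical Polynomial Pointwise

namespace Literature.NumberTheory.EllipticCurves.IwasawaAlgebra

/-! ## §1 One non-zero scalar pushes a finitely generated module over a domain into a free submodule -/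

section Domain

variable {R : Type*} [CommRing R] [IsDomain R] {M : Type*} [AddCommGroup M] [Module R M]

/-- **Free envelope up to a scalar.** A finitely generated module `M` over a domain `R` contains a
linearly independent subset `s` and a non-zero `d ∈ R` with `d • M ⊆ span s` (`s` a maximal linearly
independent subset: every `x` has `a_x • x ∈ span s` with `a_x ≠ 0`, and `d` is the product of the `a_g`
over a finite generating set). [cite: NeukirchSchmidtWingberg2008, Ch. V §1 (5.1.7)–(5.1.8)] -/
theorem exists_linearIndependent_ne_zero_forall_smul_mem_span [Module.Finite R M] :
    ∃ (s : Set M) (d : R), LinearIndependent R ((↑) : s → M) ∧ d ≠ 0 ∧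
      ∀ x : M, d • x ∈ Submodule.span R (Set.range ((↑) : s → M)) := by
  obtain ⟨s, hs, hmax⟩ := exists_maximal_linearIndepOn R (id : M → M)
  have hall : ∀ x : M, ∃ a : R, a ≠ 0 ∧ a • x ∈ Submodule.span R s := by
    intro x
    by_cases hx : x ∈ s
    · exact ⟨1, one_ne_zero, by rw [one_smul]; exact Submodule.subset_span hx⟩
    · obtain ⟨a, ha, hax⟩ := hmax x hx
      exact ⟨a, ha, by simpa using hax⟩
  choose a ha hax using hall
  obtain ⟨G, hG⟩ := Module.Finite.fg_top (R := R) (M := M)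
  refine ⟨s, ∏ g ∈ G, a g, hs.linearIndependent, Finset.prod_ne_zero_iff.mpr fun g _ => ha g, ?_⟩
  intro x
  rw [Subtype.range_coe]
  have hx : x ∈ Submodule.span R (G : Set M) := by rw [hG]; exact Submodule.mem_top
  induction hx using Submodule.span_induction with
  | mem g hg =>
    rw [← Finset.prod_erase_mul G a hg, mul_smul]
    exact Submodule.smul_mem _ _ (hax g)
  | zero => rw [smul_zero]; exact Submodule.zero_mem _
  | add x y _ _ hx hy => rw [smul_add]; exact Submodule.add_mem _ hx hy
  | smul r x _ hx => rw [smul_smul, mul_comm, mul_smul]; exact Submodule.smul_mem _ r hx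

end Domain

variable (p : ℕ) [hp : Fact p.Prime]

section Module

variable {M : Type*} [AddCommGroup M] [Module (IwasawaAlgebra p) M]

/-! ## §2 `S_m`-torsion image at infinitely many `q_m` forces `Λ`-torsion -/

/-- **MAIN.** Let `M` be a finitely generated `Λ`-module and `y ∈ M`. If for infinitely many `m ≥ 1`
there is `λ_m ∈ Λ` with `q_m ∤ λ_m` and `λ_m • y ∈ q_m M` (the image of `y` in the `S_m = Λ/(q_m)`-module
`M/q_m M` is `S_m`-torsion), then `y` is `Λ`-torsion: `d • y = 0` for some `d ≠ 0`. Proof: with §1,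
`u = d² y` lies in a free submodule with coordinates `cᵢ`, and `λ_m u = q_m • (d² z_m)` there gives
`q_m ∣ λ_m cᵢ`, so `q_m ∣ cᵢ` (`q_m` prime); infinitely many Eisenstein divisors force `cᵢ = 0`
(`finite_setOf_X_pow_add_C_dvd`). [cite: Howard2004HeegnerKolyvagin, proof of Thm. 2.2.10 (Σ_Λ; 𝔮 = T^m + p)]
[cite: GreenbergLNM1716, §4 p. 117] -/
theorem exists_ne_zero_and_smul_eq_zero_of_infinite [Module.Finite (IwasawaAlgebra p) M] {y : M}
    (hy : {m : ℕ | 1 ≤ m ∧ ∃ c : IwasawaAlgebra p,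
      ¬ (PowerSeries.X ^ m + PowerSeries.C (p : ℤ_[p]) : IwasawaAlgebra p) ∣ c ∧
      c • y ∈ (PowerSeries.X ^ m + PowerSeries.C (p : ℤ_[p]) : IwasawaAlgebra p) •
        (⊤ : Submodule (IwasawaAlgebra p) M)}.Infinite) :
    ∃ d : IwasawaAlgebra p, d ≠ 0 ∧ d • y = 0 := by
  obtain ⟨s, d, hs, hd, hdM⟩ :=
    exists_linearIndependent_ne_zero_forall_smul_mem_span (R := IwasawaAlgebra p) (M := M)
  set N : Submodule (IwasawaAlgebra p) M :=
    Submodule.span (IwasawaAlgebra p) (Set.range ((↑) : s → M)) with hN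
  let b : Module.Basis s (IwasawaAlgebra p) N := Module.Basis.span hs
  have hu : d • d • y ∈ N := hdM (d • y)
  -- every coordinate of `u = d² y` vanishes
  have key : ∀ i : s, b.repr ⟨d • d • y, hu⟩ i = 0 := by
    intro i
    by_contra hne
    refine ((finite_setOf_X_pow_add_C_dvd p hne).subset ?_).not_infinite hy
    rintro m ⟨hm, c, hc, hcy⟩
    refine ⟨hm, ?_⟩
    obtain ⟨z, -, hz⟩ := (Submodule.mem_smul_pointwise_iff_exists _ _ _).1 hcy
    -- `hz : q_m • z = c • y`
    have hdz : d • d • z ∈ N := hdM (d • z)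
    have heq : c • (⟨d • d • y, hu⟩ : N) =
        (PowerSeries.X ^ m + PowerSeries.C (p : ℤ_[p]) : IwasawaAlgebra p) • (⟨d • d • z, hdz⟩ : N) := by
      apply Subtype.ext
      simp only [Submodule.coe_smul, smul_smul]
      rw [show c * (d * d) = d * d * c by ring, mul_smul, ← hz, smul_smul]
      congr 1
      ring
    have hcoord := congrArg (fun v : N => b.repr v i) heq
    simp only [map_smul, Finsupp.smul_apply, smul_eq_mul] at hcoord
    -- `hcoord : c * b.repr u i = q_m * b.repr w i`
    have hdvd : (PowerSeries.X ^ m + PowerSeries.C (p : ℤ_[p]) : IwasawaAlgebra p) ∣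
        c * b.repr ⟨d • d • y, hu⟩ i := by
      rw [hcoord]; exact dvd_mul_right _ _
    exact ((prime_X_pow_add_C p hm).dvd_or_dvd hdvd).resolve_left hc
  have hu0 : d • d • y = 0 := by
    have h0 : (⟨d • d • y, hu⟩ : N) = 0 :=
      b.repr.map_eq_zero_iff.mp (Finsupp.ext fun i => by simpa using key i)
    simpa using congrArg Subtype.val h0
  exact ⟨d * d, mul_ne_zero hd hd, by rw [mul_smul]; exact hu0⟩

/-- **`y ∈ q_m M` for infinitely many `m` forces `y` to be `Λ`-torsion** (`M` finitely generated):
the case `λ_m = 1` of `exists_ne_zero_and_smul_eq_zero_of_infinite` (`q_m` is not a unit for `m ≥ 1`;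
`m = 0` is discarded). [cite: Howard2004HeegnerKolyvagin, proof of Thm. 2.2.10]
[cite: GreenbergLNM1716, §4 p. 117] -/
theorem exists_ne_zero_and_smul_eq_zero_of_infinite_setOf_mem_smul_top
    [Module.Finite (IwasawaAlgebra p) M] {y : M}
    (hy : {m : ℕ | y ∈ (PowerSeries.X ^ m + PowerSeries.C (p : ℤ_[p]) : IwasawaAlgebra p) •
      (⊤ : Submodule (IwasawaAlgebra p) M)}.Infinite) :
    ∃ d : IwasawaAlgebra p, d ≠ 0 ∧ d • y = 0 := by
  refine exists_ne_zero_and_smul_eq_zero_of_infinite p ((hy.sdiff (Set.finite_singleton 0)).mono ?_)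
  rintro m ⟨hm, hm0⟩
  have hm1 : 1 ≤ m := Nat.one_le_iff_ne_zero.mpr (by simpa using hm0)
  exact ⟨hm1, 1, fun h => not_isUnit_X_pow_add_C p hm1 (isUnit_of_dvd_one h), by rwa [one_smul]⟩

/-- **Torsion-free case: `y ∈ q_m M` for infinitely many `m` forces `y = 0`.**
[cite: Howard2004HeegnerKolyvagin, proof of Thm. 2.2.10] [cite: GreenbergLNM1716, §4 p. 117] -/
theorem eq_zero_of_infinite_setOf_mem_smul_top [Module.Finite (IwasawaAlgebra p) M]
    [NoZeroSMulDivisors (IwasawaAlgebra p) M] {y : M}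
    (hy : {m : ℕ | y ∈ (PowerSeries.X ^ m + PowerSeries.C (p : ℤ_[p]) : IwasawaAlgebra p) •
      (⊤ : Submodule (IwasawaAlgebra p) M)}.Infinite) :
    y = 0 := by
  obtain ⟨d, hd, hdy⟩ := exists_ne_zero_and_smul_eq_zero_of_infinite_setOf_mem_smul_top p hy
  exact (smul_eq_zero.mp hdy).resolve_left hd

/-- **`⋂_{m ∈ I} q_m M ⊆ M_{Λ-tors}` for every infinite `I ⊆ ℕ`** (`M` finitely generated).
[cite: Howard2004HeegnerKolyvagin, proof of Thm. 2.2.10] [cite: GreenbergLNM1716, §4 p. 117] -/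
theorem iInf_smul_top_le_torsion [Module.Finite (IwasawaAlgebra p) M] {I : Set ℕ} (hI : I.Infinite) :
    ⨅ m ∈ I, ((PowerSeries.X ^ m + PowerSeries.C (p : ℤ_[p]) : IwasawaAlgebra p) •
      (⊤ : Submodule (IwasawaAlgebra p) M)) ≤ Submodule.torsion (IwasawaAlgebra p) M := by
  intro y hy
  have hy' : ∀ m ∈ I, y ∈ (PowerSeries.X ^ m + PowerSeries.C (p : ℤ_[p]) : IwasawaAlgebra p) •
      (⊤ : Submodule (IwasawaAlgebra p) M) := by
    intro m hm
    exact (Submodule.mem_iInf _).1 ((Submodule.mem_iInf _).1 hy m) hm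
  obtain ⟨d, hd, hdy⟩ := exists_ne_zero_and_smul_eq_zero_of_infinite_setOf_mem_smul_top p
    (hI.mono fun m hm => hy' m hm)
  exact (Submodule.mem_torsion_iff y).mpr ⟨⟨d, mem_nonZeroDivisors_of_ne_zero hd⟩, hdy⟩

/-- **Torsion-free case: `⋂_{m ∈ I} q_m M = 0` for every infinite `I ⊆ ℕ`.**
[cite: Howard2004HeegnerKolyvagin, proof of Thm. 2.2.10] [cite: GreenbergLNM1716, §4 p. 117] -/
theorem iInf_smul_top_eq_bot [Module.Finite (IwasawaAlgebra p) M]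
    [NoZeroSMulDivisors (IwasawaAlgebra p) M] {I : Set ℕ} (hI : I.Infinite) :
    ⨅ m ∈ I, ((PowerSeries.X ^ m + PowerSeries.C (p : ℤ_[p]) : IwasawaAlgebra p) •
      (⊤ : Submodule (IwasawaAlgebra p) M)) = ⊥ := by
  rw [eq_bot_iff]
  intro y hy
  have hy' : ∀ m ∈ I, y ∈ (PowerSeries.X ^ m + PowerSeries.C (p : ℤ_[p]) : IwasawaAlgebra p) •
      (⊤ : Submodule (IwasawaAlgebra p) M) := by
    intro m hm
    exact (Submodule.mem_iInf _).1 ((Submodule.mem_iInf _).1 hy m) hm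
  exact (Submodule.mem_bot _).mpr
    (eq_zero_of_infinite_setOf_mem_smul_top p (hI.mono fun m hm => hy' m hm))

/-! ## §3 Eventual forms: a non-torsion element has `S_m`-torsion-free image for `m ≫ 0` -/

/-- **A non-torsion `y` has `S_m`-torsion-free image in `M/q_m M` for all `m ≥ m₁`**: `λ • y ∉ q_m M`
whenever `q_m ∤ λ` (in particular `y ∉ q_m M`). Howard's "`κ₁^{(𝔮)}` generates an infinite
`S_𝔮`-submodule for all but finitely many height-one primes", along the Eisenstein family.
[cite: Howard2004HeegnerKolyvagin, proof of Thm. 2.2.10 (Σ_Λ)] [cite: GreenbergLNM1716, §4 p. 117] -/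
theorem exists_forall_not_mem_smul_top_of_not_dvd [Module.Finite (IwasawaAlgebra p) M] {y : M}
    (hy : ∀ d : IwasawaAlgebra p, d ≠ 0 → d • y ≠ 0) :
    ∃ m₁ : ℕ, ∀ m, m₁ ≤ m → ∀ c : IwasawaAlgebra p,
      ¬ (PowerSeries.X ^ m + PowerSeries.C (p : ℤ_[p]) : IwasawaAlgebra p) ∣ c →
      c • y ∉ (PowerSeries.X ^ m + PowerSeries.C (p : ℤ_[p]) : IwasawaAlgebra p) •
        (⊤ : Submodule (IwasawaAlgebra p) M) := by
  by_contra h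
  push Not at h
  have hinf : {m : ℕ | 1 ≤ m ∧ ∃ c : IwasawaAlgebra p,
      ¬ (PowerSeries.X ^ m + PowerSeries.C (p : ℤ_[p]) : IwasawaAlgebra p) ∣ c ∧
      c • y ∈ (PowerSeries.X ^ m + PowerSeries.C (p : ℤ_[p]) : IwasawaAlgebra p) •
        (⊤ : Submodule (IwasawaAlgebra p) M)}.Infinite := by
    refine Nat.frequently_atTop_iff_infinite.mp (Filter.frequently_atTop.mpr fun a => ?_)
    obtain ⟨m, hm, c, hc, hcy⟩ := h (a + 1)
    exact ⟨m, by omega, by omega, c, hc, hcy⟩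
  obtain ⟨d, hd, hdy⟩ := exists_ne_zero_and_smul_eq_zero_of_infinite p hinf
  exact hy d hd hdy

/-- **Eventual non-membership in a controlled family of submodules.** If `K_m ≤ M` (`m ≥ m₀`) satisfy
`d • K_m ⊆ q_m M` for ONE `d ≠ 0` (e.g. `K_m ⊇ q_m M` of index bounded in `m`, `d` = that bound's
factorial; or `K_m = 𝔖 ∩ q_m H¹`), then a non-torsion `y` lies outside `K_m` for all `m ≥ m₁` — indeed
`λ • y ∉ K_m` whenever `q_m ∤ λ`. [cite: Howard2004HeegnerKolyvagin, proof of Thm. 2.2.10 (Σ_Λ)]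
[cite: GreenbergLNM1716, §4 p. 117] -/
theorem exists_forall_smul_not_mem_of_forall_smul_mem [Module.Finite (IwasawaAlgebra p) M] {y : M}
    (hy : ∀ d : IwasawaAlgebra p, d ≠ 0 → d • y ≠ 0) (K : ℕ → Submodule (IwasawaAlgebra p) M)
    {d : IwasawaAlgebra p} (hd : d ≠ 0) {m₀ : ℕ}
    (hK : ∀ m, m₀ ≤ m → ∀ x ∈ K m, d • x ∈
      (PowerSeries.X ^ m + PowerSeries.C (p : ℤ_[p]) : IwasawaAlgebra p) •
        (⊤ : Submodule (IwasawaAlgebra p) M)) :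
    ∃ m₁ : ℕ, ∀ m, m₁ ≤ m → ∀ c : IwasawaAlgebra p,
      ¬ (PowerSeries.X ^ m + PowerSeries.C (p : ℤ_[p]) : IwasawaAlgebra p) ∣ c → c • y ∉ K m := by
  have hdy : ∀ a : IwasawaAlgebra p, a ≠ 0 → a • d • y ≠ 0 := by
    intro a ha h
    exact hy (a * d) (mul_ne_zero ha hd) (by rwa [mul_smul])
  obtain ⟨m₁, hm₁⟩ := exists_forall_not_mem_smul_top_of_not_dvd p hdy
  refine ⟨max m₀ m₁, fun m hm c hc hcy => hm₁ m (le_of_max_le_right hm) c hc ?_⟩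
  rw [smul_comm]
  exact hK m (le_of_max_le_left hm) _ hcy

end Module

/-! ## §4 Map form: the specialised class is non-zero (indeed `S_m`-torsion-free) for `m ≫ 0` -/

section Maps

variable {M : Type*} [AddCommGroup M] [Module (IwasawaAlgebra p) M]
  {M' : Type*} [AddCommGroup M'] [Module (IwasawaAlgebra p) M']
  {H : ℕ → Type*} [∀ m, AddCommGroup (H m)] [∀ m, Module (IwasawaAlgebra p) (H m)]

/-- **Non-vanishing of the specialised class for `m ≫ 0`.** Let `f_m : M → H_m` (`m ≥ m₀`) be
`Λ`-linear maps whose kernels are controlled by an ambient finitely generated `Λ`-module `M'` through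
`ι : M → M'`: `f_m x = 0 ⟹ ι x ∈ q_m M'` (for the specialisation `H¹(K,𝐓) ⊇ 𝔖 → H¹(K, T_{q_m})` the
kernel is `𝔖 ∩ q_m H¹(K,𝐓)`). If `ι y` is non-torsion, then for all `m ≥ m₁`: `λ • f_m y ≠ 0` whenever
`q_m ∤ λ`, i.e. `f_m y` is `S_m`-torsion-free ("`κ₁^{(𝔮)}` generates an infinite `S_𝔮`-submodule").
[cite: Howard2004HeegnerKolyvagin, proof of Thm. 2.2.10 (Σ_Λ; 𝔮 = T^m + p)] [cite: GreenbergLNM1716, §4 p. 117] -/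
theorem exists_forall_smul_map_ne_zero [Module.Finite (IwasawaAlgebra p) M']
    (f : ∀ m, M →ₗ[IwasawaAlgebra p] H m) (ι : M →ₗ[IwasawaAlgebra p] M') {m₀ : ℕ}
    (hker : ∀ m, m₀ ≤ m → ∀ x : M, f m x = 0 → ι x ∈
      (PowerSeries.X ^ m + PowerSeries.C (p : ℤ_[p]) : IwasawaAlgebra p) •
        (⊤ : Submodule (IwasawaAlgebra p) M'))
    {y : M} (hy : ∀ d : IwasawaAlgebra p, d ≠ 0 → d • ι y ≠ 0) :
    ∃ m₁ : ℕ, ∀ m, m₁ ≤ m → ∀ c : IwasawaAlgebra p,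
      ¬ (PowerSeries.X ^ m + PowerSeries.C (p : ℤ_[p]) : IwasawaAlgebra p) ∣ c → c • f m y ≠ 0 := by
  obtain ⟨m₁, hm₁⟩ := exists_forall_not_mem_smul_top_of_not_dvd p hy
  refine ⟨max m₀ m₁, fun m hm c hc h0 => hm₁ m (le_of_max_le_right hm) c hc ?_⟩
  rw [← map_smul]
  exact hker m (le_of_max_le_left hm) _ (by rw [map_smul, h0])

/-- **`f_m y ≠ 0` for `m ≫ 0`** (the case `λ = 1` of `exists_forall_smul_map_ne_zero`): the binder
`hκ : κ₁ ≠ 0` of the specialised Kolyvagin-system witness at every large level from ONE non-torsion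
class. [cite: Howard2004HeegnerKolyvagin, proof of Thm. 2.2.10 (Σ_Λ; 𝔮 = T^m + p)] -/
theorem exists_forall_map_ne_zero [Module.Finite (IwasawaAlgebra p) M']
    (f : ∀ m, M →ₗ[IwasawaAlgebra p] H m) (ι : M →ₗ[IwasawaAlgebra p] M') {m₀ : ℕ}
    (hker : ∀ m, m₀ ≤ m → ∀ x : M, f m x = 0 → ι x ∈
      (PowerSeries.X ^ m + PowerSeries.C (p : ℤ_[p]) : IwasawaAlgebra p) •
        (⊤ : Submodule (IwasawaAlgebra p) M'))
    {y : M} (hy : ∀ d : IwasawaAlgebra p, d ≠ 0 → d • ι y ≠ 0) :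
    ∃ m₁ : ℕ, ∀ m, m₁ ≤ m → f m y ≠ 0 := by
  obtain ⟨m₁, hm₁⟩ := exists_forall_smul_map_ne_zero p f ι hker hy
  refine ⟨max m₁ 1, fun m hm h0 => hm₁ m (le_of_max_le_left hm) 1
    (fun h => not_isUnit_X_pow_add_C p (le_of_max_le_right hm) (isUnit_of_dvd_one h)) ?_⟩
  rw [one_smul, h0]

/-- **`f_m(L) ≠ 0` for `m ≫ 0`** for every submodule `L ∋ y` (so a generator `κ₁` of the cyclic
`S_m`-module `f_m(Λκ_∞)` is non-zero). [cite: Howard2004HeegnerKolyvagin, proof of Thm. 2.2.10 (Σ_Λ; 𝔮 = T^m + p)] -/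
theorem exists_forall_map_ne_bot [Module.Finite (IwasawaAlgebra p) M']
    (f : ∀ m, M →ₗ[IwasawaAlgebra p] H m) (ι : M →ₗ[IwasawaAlgebra p] M') {m₀ : ℕ}
    (hker : ∀ m, m₀ ≤ m → ∀ x : M, f m x = 0 → ι x ∈
      (PowerSeries.X ^ m + PowerSeries.C (p : ℤ_[p]) : IwasawaAlgebra p) •
        (⊤ : Submodule (IwasawaAlgebra p) M'))
    {y : M} (hy : ∀ d : IwasawaAlgebra p, d ≠ 0 → d • ι y ≠ 0)
    (L : Submodule (IwasawaAlgebra p) M) (hyL : y ∈ L) :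
    ∃ m₁ : ℕ, ∀ m, m₁ ≤ m → L.map (f m) ≠ ⊥ := by
  obtain ⟨m₁, hm₁⟩ := exists_forall_map_ne_zero p f ι hker hy
  refine ⟨m₁, fun m hm h => hm₁ m hm ?_⟩
  rw [← Submodule.mem_bot (R := IwasawaAlgebra p), ← h]
  exact Submodule.mem_map_of_mem hyL

/-- **Non-torsion from torsion-free + non-zero** (the form in which the hypothesis `hy` arises:
`𝔖 ⊆ H¹(K,𝐓)` torsion-free and `κ_∞ ≠ 0`). [cite: Howard2004HeegnerKolyvagin, Lemma 2.2.9 / proof of Thm. 2.2.10] -/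
theorem forall_smul_ne_zero_of_ne_zero [NoZeroSMulDivisors (IwasawaAlgebra p) M'] {y : M'}
    (hy : y ≠ 0) : ∀ d : IwasawaAlgebra p, d ≠ 0 → d • y ≠ 0 :=
  fun _ hd h => (smul_eq_zero.mp h).elim hd hy

/-- **Translation to `S_m`-modules.** On an `S_m = Λ/(q_m)`-module `H₀` (with its `Λ`-structure
through `Λ → S_m`), "`λ • h ≠ 0` whenever `q_m ∤ λ`" says exactly that no non-zero element of `S_m`
kills `h`, i.e. `h` is `S_m`-torsion-free ("generates an infinite `S_𝔮`-submodule", `S_𝔮` being a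
domain all of whose proper quotients are finite). [cite: Howard2004HeegnerKolyvagin, proof of Thm. 2.2.10 (Σ_Λ)] -/
theorem forall_quotient_smul_ne_zero_of_forall_smul_ne_zero {m : ℕ} {H₀ : Type*} [AddCommGroup H₀]
    [Module (IwasawaAlgebra p) H₀]
    [Module (IwasawaAlgebra p ⧸
      Ideal.span {(PowerSeries.X ^ m + PowerSeries.C (p : ℤ_[p]) : IwasawaAlgebra p)}) H₀]
    [IsScalarTower (IwasawaAlgebra p) (IwasawaAlgebra p ⧸
      Ideal.span {(PowerSeries.X ^ m + PowerSeries.C (p : ℤ_[p]) : IwasawaAlgebra p)}) H₀]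
    {h : H₀} (hh : ∀ c : IwasawaAlgebra p,
      ¬ (PowerSeries.X ^ m + PowerSeries.C (p : ℤ_[p]) : IwasawaAlgebra p) ∣ c → c • h ≠ 0) :
    ∀ s : IwasawaAlgebra p ⧸
      Ideal.span {(PowerSeries.X ^ m + PowerSeries.C (p : ℤ_[p]) : IwasawaAlgebra p)},
      s ≠ 0 → s • h ≠ 0 := by
  intro s hs
  obtain ⟨c, rfl⟩ := Ideal.Quotient.mk_surjective s
  have hc : ¬ (PowerSeries.X ^ m + PowerSeries.C (p : ℤ_[p]) : IwasawaAlgebra p) ∣ c := fun hdvd =>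
    hs (Ideal.Quotient.eq_zero_iff_mem.mpr (Ideal.mem_span_singleton.mpr hdvd))
  rw [← Ideal.Quotient.algebraMap_eq, IsScalarTower.algebraMap_smul]
  exact hh c hc

end Maps

/-! ## §5 The generator `κ₁`: a `Λ`-submodule of a free rank-one `S_m`-module is `Λ`-cyclic -/

section Generator

variable {M : Type*} [AddCommGroup M] [Module (IwasawaAlgebra p) M]

/-- **`Λ`-submodules of `H₀ ≅ S_m` are `Λ`-cyclic.** On an `S_m`-module `H₀` with `H₀ ≃ S_m` (`Λ` acting
through `Λ ↠ S_m`), every `Λ`-submodule `P` is an `S_m`-submodule (same carrier), corresponds to an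
ideal of the principal ideal ring `S_m` (a DVR, `isDiscreteValuationRing_quotient_X_pow_add_C`), and
is therefore `P = Λ ∙ κ₁` for some `κ₁`. This manufactures the element `κ₁` with `f(Λκ_∞) = Λκ₁` of the
specialised Kolyvagin system. [cite: Howard2004HeegnerKolyvagin, proof of Thm. 2.2.10 (κ₁^{(𝔮)}; S_𝔮 a DVR)]
[cite: SerreLocalFields1979, I §6 (Eisenstein ⇒ DVR)] -/
theorem exists_eq_span_singleton_of_linearEquiv_quotient {m : ℕ} (hm : 1 ≤ m) {H₀ : Type*}
    [AddCommGroup H₀] [Module (IwasawaAlgebra p) H₀]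
    [Module (IwasawaAlgebra p ⧸
      Ideal.span {(PowerSeries.X ^ m + PowerSeries.C (p : ℤ_[p]) : IwasawaAlgebra p)}) H₀]
    [IsScalarTower (IwasawaAlgebra p) (IwasawaAlgebra p ⧸
      Ideal.span {(PowerSeries.X ^ m + PowerSeries.C (p : ℤ_[p]) : IwasawaAlgebra p)}) H₀]
    (e : H₀ ≃ₗ[IwasawaAlgebra p ⧸
      Ideal.span {(PowerSeries.X ^ m + PowerSeries.C (p : ℤ_[p]) : IwasawaAlgebra p)}]
      (IwasawaAlgebra p ⧸
        Ideal.span {(PowerSeries.X ^ m + PowerSeries.C (p : ℤ_[p]) : IwasawaAlgebra p)}))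
    (P : Submodule (IwasawaAlgebra p) H₀) :
    ∃ κ₁ : H₀, P = Submodule.span (IwasawaAlgebra p) {κ₁} := by
  haveI := isDiscreteValuationRing_quotient_X_pow_add_C p hm
  -- `P` is an `S_m`-submodule (same carrier)
  let PS : Submodule (IwasawaAlgebra p ⧸
      Ideal.span {(PowerSeries.X ^ m + PowerSeries.C (p : ℤ_[p]) : IwasawaAlgebra p)}) H₀ :=
    { carrier := P
      add_mem' := fun ha hb => P.add_mem ha hb
      zero_mem' := P.zero_mem
      smul_mem' := fun s x hx => by
        obtain ⟨c, rfl⟩ := Ideal.Quotient.mk_surjective s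
        show Ideal.Quotient.mk _ c • x ∈ P
        rw [← Ideal.Quotient.algebraMap_eq, IsScalarTower.algebraMap_smul]
        exact P.smul_mem c hx }
  have hPS : ∀ x : H₀, x ∈ PS ↔ x ∈ P := fun x => Iff.rfl
  -- its image under `e` is a principal ideal of `S_m`
  obtain ⟨g, hg⟩ := (IsPrincipalIdealRing.principal (PS.map (e : H₀ →ₗ[IwasawaAlgebra p ⧸
      Ideal.span {(PowerSeries.X ^ m + PowerSeries.C (p : ℤ_[p]) : IwasawaAlgebra p)}]
      (IwasawaAlgebra p ⧸
        Ideal.span {(PowerSeries.X ^ m + PowerSeries.C (p : ℤ_[p]) : IwasawaAlgebra p)})))).principal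
  have hg' : g ∈ PS.map (e : H₀ →ₗ[IwasawaAlgebra p ⧸
      Ideal.span {(PowerSeries.X ^ m + PowerSeries.C (p : ℤ_[p]) : IwasawaAlgebra p)}]
      (IwasawaAlgebra p ⧸
        Ideal.span {(PowerSeries.X ^ m + PowerSeries.C (p : ℤ_[p]) : IwasawaAlgebra p)})) := by
    rw [hg]; exact Submodule.mem_span_singleton_self g
  obtain ⟨x₁, hx₁, hx₁e⟩ := hg'
  have hsymm : e.symm g = x₁ := by rw [← hx₁e]; exact e.symm_apply_apply x₁
  refine ⟨e.symm g, le_antisymm ?_ ?_⟩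
  · intro x hx
    have hex : e x ∈ PS.map (e : H₀ →ₗ[IwasawaAlgebra p ⧸
        Ideal.span {(PowerSeries.X ^ m + PowerSeries.C (p : ℤ_[p]) : IwasawaAlgebra p)}]
        (IwasawaAlgebra p ⧸
          Ideal.span {(PowerSeries.X ^ m + PowerSeries.C (p : ℤ_[p]) : IwasawaAlgebra p)})) :=
      ⟨x, (hPS x).mpr hx, rfl⟩
    rw [hg, Submodule.mem_span_singleton] at hex
    obtain ⟨s, hs⟩ := hex
    obtain ⟨c, rfl⟩ := Ideal.Quotient.mk_surjective s
    rw [Submodule.mem_span_singleton]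
    refine ⟨c, e.injective ?_⟩
    rw [← IsScalarTower.algebraMap_smul (IwasawaAlgebra p ⧸
      Ideal.span {(PowerSeries.X ^ m + PowerSeries.C (p : ℤ_[p]) : IwasawaAlgebra p)}) c,
      Ideal.Quotient.algebraMap_eq, map_smul, e.apply_symm_apply, hs]
  · rw [Submodule.span_le, Set.singleton_subset_iff, SetLike.mem_coe, hsymm]
    exact (hPS x₁).mp hx₁

/-- **The non-zero generator.** With `e : H₀ ≃ S_m` as above and a `Λ`-linear `f : M → H₀`, a submodule
`L ≤ M` with `f(L) ≠ 0` has `f(L) = Λ ∙ κ₁` with `κ₁ ≠ 0` — combine with `exists_forall_map_ne_bot`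
(`f(L) ≠ 0` for `m ≫ 0`) to obtain the binders `hL : L.map f ≤ Λ ∙ κ₁` and `hκ : κ₁ ≠ 0` of the
specialised witness at every large level. [cite: Howard2004HeegnerKolyvagin, proof of Thm. 2.2.10 (κ₁^{(𝔮)} ≠ 0 for 𝔮 ∉ Σ_Λ)] -/
theorem exists_ne_zero_map_eq_span_singleton {m : ℕ} (hm : 1 ≤ m) {H₀ : Type*}
    [AddCommGroup H₀] [Module (IwasawaAlgebra p) H₀]
    [Module (IwasawaAlgebra p ⧸
      Ideal.span {(PowerSeries.X ^ m + PowerSeries.C (p : ℤ_[p]) : IwasawaAlgebra p)}) H₀]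
    [IsScalarTower (IwasawaAlgebra p) (IwasawaAlgebra p ⧸
      Ideal.span {(PowerSeries.X ^ m + PowerSeries.C (p : ℤ_[p]) : IwasawaAlgebra p)}) H₀]
    (e : H₀ ≃ₗ[IwasawaAlgebra p ⧸
      Ideal.span {(PowerSeries.X ^ m + PowerSeries.C (p : ℤ_[p]) : IwasawaAlgebra p)}]
      (IwasawaAlgebra p ⧸
        Ideal.span {(PowerSeries.X ^ m + PowerSeries.C (p : ℤ_[p]) : IwasawaAlgebra p)}))
    (f : M →ₗ[IwasawaAlgebra p] H₀) (L : Submodule (IwasawaAlgebra p) M) (hL : L.map f ≠ ⊥) :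
    ∃ κ₁ : H₀, κ₁ ≠ 0 ∧ L.map f = Submodule.span (IwasawaAlgebra p) {κ₁} := by
  obtain ⟨κ₁, hκ₁⟩ := exists_eq_span_singleton_of_linearEquiv_quotient p hm e (L.map f)
  refine ⟨κ₁, fun h0 => hL ?_, hκ₁⟩
  rw [hκ₁, h0, Submodule.span_singleton_eq_bot]

end Generator

/-! ## §6 Choosing the generator AMONG the given generators (local rings)

For the Kolyvagin-system argument the generator `κ₁` of `f(L)` must be (a unit multiple of) the image
of one of the given classes, not an abstract generator: over a LOCAL ring a principal submodule
spanned by a set `A` is spanned by an element of `A` (Nakayama for a cyclic module). -/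

section LocalGenerator

variable {R : Type*} [CommRing R] [IsLocalRing R] {M : Type*} [AddCommGroup M] [Module R M]

/-- **Over a local ring, a principal submodule `span A = R ∙ κ` is `R ∙ a` for some `a ∈ A`** (`A`
nonempty): either some `a ∈ A` is a unit multiple of `κ`, or `A ⊆ 𝔪κ`, whence `κ ∈ 𝔪κ`, `κ = 0`, `A ⊆ {0}`.
[cite: Howard2004HeegnerKolyvagin, proof of Thm. 2.2.10 (the generator κ₁^{(𝔮)} is the specialised class itself)] -/
theorem exists_mem_span_eq_span_singleton_of_span_eq (A : Set M) (hA : A.Nonempty) (κ : M)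
    (h : Submodule.span R A = Submodule.span R {κ}) :
    ∃ a ∈ A, Submodule.span R A = Submodule.span R {a} := by
  classical
  by_cases hu : ∃ a ∈ A, ∃ r : R, IsUnit r ∧ r • κ = a
  · obtain ⟨a, haA, r, hr, rfl⟩ := hu
    exact ⟨r • κ, haA, by rw [h, Submodule.span_singleton_smul_eq hr]⟩
  · push Not at hu
    have hsub : Submodule.span R A ≤ (IsLocalRing.maximalIdeal R) • Submodule.span R {κ} := by
      rw [Submodule.span_le]
      intro a haA
      have haκ : a ∈ Submodule.span R {κ} := by rw [← h]; exact Submodule.subset_span haA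
      obtain ⟨r, rfl⟩ := Submodule.mem_span_singleton.mp haκ
      have hr : r ∈ IsLocalRing.maximalIdeal R := by
        rw [IsLocalRing.mem_maximalIdeal, mem_nonunits_iff]
        exact fun hunit => hu _ haA r hunit rfl
      exact Submodule.mem_smul_span_singleton.mpr ⟨r, hr, rfl⟩
    have hκA : κ ∈ Submodule.span R A := by rw [h]; exact Submodule.mem_span_singleton_self κ
    obtain ⟨μ, hμ, hμκ⟩ := Submodule.mem_smul_span_singleton.mp (hsub hκA)
    have h1 : IsUnit (1 - μ) :=
      IsLocalRing.isUnit_one_sub_self_of_mem_nonunits μ ((IsLocalRing.mem_maximalIdeal μ).mp hμ)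
    have hκ0 : κ = 0 := by
      have h0 : (1 - μ) • κ = (1 - μ) • (0 : M) := by
        rw [sub_smul, one_smul, hμκ, sub_self, smul_zero]
      exact h1.smul_left_cancel.mp h0
    have hbot : Submodule.span R A = ⊥ := by
      rw [h, Submodule.span_singleton_eq_bot]; exact hκ0
    obtain ⟨a₀, ha₀⟩ := hA
    have ha0 : a₀ = 0 := by
      have ha₀A : a₀ ∈ Submodule.span R A := Submodule.subset_span ha₀
      rw [hbot] at ha₀A
      exact (Submodule.mem_bot R).mp ha₀A
    refine ⟨a₀, ha₀, ?_⟩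
    rw [hbot, ha0, eq_comm, Submodule.span_singleton_eq_bot]

end LocalGenerator

section GeneratorAmong

variable {M : Type*} [AddCommGroup M] [Module (IwasawaAlgebra p) M]

/-- **On `H₀ ≅ S_m`, a `Λ`-submodule spanned by a set `A` is `Λ ∙ a` for some `a ∈ A`** (`Λ` is local;
§5 makes `span A` principal). [cite: Howard2004HeegnerKolyvagin, proof of Thm. 2.2.10]
[cite: SerreLocalFields1979, I §6] -/
theorem exists_mem_span_eq_span_singleton_of_linearEquiv_quotient {m : ℕ} (hm : 1 ≤ m) {H₀ : Type*}
    [AddCommGroup H₀] [Module (IwasawaAlgebra p) H₀]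
    [Module (IwasawaAlgebra p ⧸
      Ideal.span {(PowerSeries.X ^ m + PowerSeries.C (p : ℤ_[p]) : IwasawaAlgebra p)}) H₀]
    [IsScalarTower (IwasawaAlgebra p) (IwasawaAlgebra p ⧸
      Ideal.span {(PowerSeries.X ^ m + PowerSeries.C (p : ℤ_[p]) : IwasawaAlgebra p)}) H₀]
    (e : H₀ ≃ₗ[IwasawaAlgebra p ⧸
      Ideal.span {(PowerSeries.X ^ m + PowerSeries.C (p : ℤ_[p]) : IwasawaAlgebra p)}]
      (IwasawaAlgebra p ⧸
        Ideal.span {(PowerSeries.X ^ m + PowerSeries.C (p : ℤ_[p]) : IwasawaAlgebra p)}))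
    (A : Set H₀) (hA : A.Nonempty) :
    ∃ a ∈ A, Submodule.span (IwasawaAlgebra p) A = Submodule.span (IwasawaAlgebra p) {a} := by
  obtain ⟨κ₁, hκ₁⟩ :=
    exists_eq_span_singleton_of_linearEquiv_quotient p hm e (Submodule.span (IwasawaAlgebra p) A)
  exact exists_mem_span_eq_span_singleton_of_span_eq A hA κ₁ hκ₁

/-- **The generator of `f(span A)` may be taken to be `f s` with `s ∈ A`.** With `e : H₀ ≃ S_m` and a
`Λ`-linear `f : M → H₀`: `f(Λ·A) = Λ ∙ f(s)` for some `s ∈ A` — so when `A` is a set of (stabilised)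
classes each carrying a Kolyvagin system, `κ₁ := f s` is the bottom class of one of them.
[cite: Howard2004HeegnerKolyvagin, proof of Thm. 2.2.10 (κ^{(𝔮)} = image of κ in KS(T_𝔮, F_𝔮, L))] -/
theorem exists_mem_map_span_eq_span_singleton {m : ℕ} (hm : 1 ≤ m) {H₀ : Type*}
    [AddCommGroup H₀] [Module (IwasawaAlgebra p) H₀]
    [Module (IwasawaAlgebra p ⧸
      Ideal.span {(PowerSeries.X ^ m + PowerSeries.C (p : ℤ_[p]) : IwasawaAlgebra p)}) H₀]
    [IsScalarTower (IwasawaAlgebra p) (IwasawaAlgebra p ⧸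
      Ideal.span {(PowerSeries.X ^ m + PowerSeries.C (p : ℤ_[p]) : IwasawaAlgebra p)}) H₀]
    (e : H₀ ≃ₗ[IwasawaAlgebra p ⧸
      Ideal.span {(PowerSeries.X ^ m + PowerSeries.C (p : ℤ_[p]) : IwasawaAlgebra p)}]
      (IwasawaAlgebra p ⧸
        Ideal.span {(PowerSeries.X ^ m + PowerSeries.C (p : ℤ_[p]) : IwasawaAlgebra p)}))
    (f : M →ₗ[IwasawaAlgebra p] H₀) (A : Set M) (hA : A.Nonempty) :
    ∃ s ∈ A, (Submodule.span (IwasawaAlgebra p) A).map f =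
      Submodule.span (IwasawaAlgebra p) {f s} := by
  rw [Submodule.map_span]
  obtain ⟨a, ⟨s, hs, rfl⟩, ha⟩ :=
    exists_mem_span_eq_span_singleton_of_linearEquiv_quotient p hm e (f '' A) (hA.image f)
  exact ⟨s, hs, ha⟩

/-- **Non-zero generator among the images.** As above with `f(Λ·A) ≠ 0`: `f(Λ·A) = Λ ∙ f(s)`, `s ∈ A`,
`f s ≠ 0` — the binders `κ₁ := f s`, `hL`, `hκ` of the specialised witness, with `κ₁` an actual
specialised class. [cite: Howard2004HeegnerKolyvagin, proof of Thm. 2.2.10] -/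
theorem exists_mem_map_span_eq_span_singleton_ne_zero {m : ℕ} (hm : 1 ≤ m) {H₀ : Type*}
    [AddCommGroup H₀] [Module (IwasawaAlgebra p) H₀]
    [Module (IwasawaAlgebra p ⧸
      Ideal.span {(PowerSeries.X ^ m + PowerSeries.C (p : ℤ_[p]) : IwasawaAlgebra p)}) H₀]
    [IsScalarTower (IwasawaAlgebra p) (IwasawaAlgebra p ⧸
      Ideal.span {(PowerSeries.X ^ m + PowerSeries.C (p : ℤ_[p]) : IwasawaAlgebra p)}) H₀]
    (e : H₀ ≃ₗ[IwasawaAlgebra p ⧸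
      Ideal.span {(PowerSeries.X ^ m + PowerSeries.C (p : ℤ_[p]) : IwasawaAlgebra p)}]
      (IwasawaAlgebra p ⧸
        Ideal.span {(PowerSeries.X ^ m + PowerSeries.C (p : ℤ_[p]) : IwasawaAlgebra p)}))
    (f : M →ₗ[IwasawaAlgebra p] H₀) (A : Set M) (hA : A.Nonempty)
    (hne : (Submodule.span (IwasawaAlgebra p) A).map f ≠ ⊥) :
    ∃ s ∈ A, f s ≠ 0 ∧ (Submodule.span (IwasawaAlgebra p) A).map f =
      Submodule.span (IwasawaAlgebra p) {f s} := by
  obtain ⟨s, hs, hfs⟩ := exists_mem_map_span_eq_span_singleton p hm e f A hA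
  refine ⟨s, hs, fun h0 => hne ?_, hfs⟩
  rw [hfs, h0, Submodule.span_singleton_eq_bot]

end GeneratorAmong

end Literature.NumberTheory.EllipticCurves.IwasawaAlgebra
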